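import Mathlib
import Summits.Ventures.PercRepro2.HCov
import Summits.Ventures.PercRepro2.RootLeafUSigns
import Summits.Ventures.PercRepro2.RootLeafUCore
import Summits.Ventures.PercRepro2.RootLeafUOu
import Summits.Ventures.PercRepro2.RootLeafUHalf
import Summits.Ventures.PercRepro2.RootLeafUMixK
import Summits.Ventures.PercRepro2.RootLeafUMixKA
import Summits.Ventures.PercRepro2.RootLeafUMixL

/-!
# (G4-u), the `o ∈ L` half: the ρ = 1 BHK step and the class `(2β + B)·δ_o ≤ (OU)·Y`
(blind cell PercRepro2, p4 g13; S3 item (aa); no definitions)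

The mirror identity of RootLeafUMixL, `W·T2oL = B·(Y_tW − tY) + 2β·[(MW − B₁Y) − (Y_bK W − P(R,bK)Y)] + (OU)·Y`,
rewritten with `1_{bL}1_{cK} = 1_{cK} − 1_{b∉L}1_{cK}` and `1_{bK} = 1_{b∉L}1_{bK}`, reads

  `W·T2oL = (|B| − 2β)·δ_o − 2β·W²·Cov_R(1_{b∉L}·(1_{c∈K} + 1_{b∈K}), 1_{o∈L}) + (OU)·Y`

(`δ_o = t·Y_N − D·Y_t ≥ 0`).  The functional `1_{b∉L}·(1_{c∈K} + 1_{b∈K})` has conditional expectation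
`χ_{b∉L}(L)·(q_c(L) + q_b(L))` given `L = C(u)` (`q_x(L) = P_{G−L}(a₂ ↔ x)`) — DECREASING in `L` — so its
covariance with `1_{o∈L}` is `≤ 0` by the functional BHK06 Thm 1.3 (`bhk_induced` on the cluster of `u`
avoiding `{a₂, c}`, `F₁ = 1_{o∈·}`, `F₂ = 2 − χ·(q_c + q_b)`): **`cov_bnotL_le`** (cleared), hence
`W·T2oL ≥ (|B| − 2β)·δ_o + (OU)·Y` and **`T2oL_nonneg_of_classL`**: `(2β + B)·δ_o ≤ (OU)·Y → 0 ≤ T2oL`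
(`B = α − κ ≤ 0`; the class contains `−B ≥ 2β`).  The exact mirror of RootLeafUMixKA on the `o ∈ K` side.
-/

namespace Summit.Ventures.PercRepro2

open UnionCluster CovForm

namespace RootLeafU

namespace MixL

variable {V : Type*} {E : Type*} [Fintype E] [DecidableEq E] [Fintype V] [DecidableEq V]
  {R : Type*} [Field R] [LinearOrder R] [IsStrictOrderedRing R]

section Sets

variable (ends : E → Sym2 V) (o a₂ c b u : V)

omit [Fintype E] [DecidableEq E] [Fintype V] in
/-- `R ∩ {a₂ ↔ c} = T` (`R = {L avoids {a₂, c}}`). -/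
lemma R_inter_a2c_eq :
    avoidAll ends u {a₂, c} ∩ connEvent ends a₂ c = TEvent ends u a₂ c := by
  rw [Set.inter_comm, conn_inter_R]

omit [Fintype E] [DecidableEq E] [Fintype V] in
/-- `R ∩ {a₂ ↮ c} = PD`. -/
lemma R_inter_a2c_compl_eq :
    avoidAll ends u {a₂, c} ∩ (connEvent ends a₂ c)ᶜ = PDEvent ends u a₂ c := by
  rw [ISplit.PD_eq_R_inter]

end Sets

section BHK

variable (p : E → R) (ends : E → Sym2 V) (o a₂ c b u : V)

/-- **The BHK step on the `L` side**: `Cov_R(1_{b∉L}·(1_{c∈K} + 1_{b∈K}), 1_{o∈L}) ≤ 0` under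
`P(· | L avoids {a₂, c})`, cleared:
`[P(T,oL) − P(T,oL,bL) + P(PD,oL,bK) + P(T,oL,bK)]·W ≤ [t − P(T,bL) + P(PD,bK) + P(T,bK)]·Y`
(`bhk_induced` on the cluster of `u` avoiding `{a₂, c}`, `F₁ = 1_{o∈·}`, `F₂ = 2 − χ_{b∉·}·(q_c + q_b)`). -/
theorem cov_bnotL_le (hp : IsProbVec p) :
    (prob p (TEvent ends u a₂ c ∩ connEvent ends u o) -
        prob p (TEvent ends u a₂ c ∩ (connEvent ends u o ∩ connEvent ends u b)) +
        prob p (PDEvent ends u a₂ c ∩ (connEvent ends u o ∩ connEvent ends a₂ b)) +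
        prob p (TEvent ends u a₂ c ∩ (connEvent ends u o ∩ connEvent ends a₂ b))) *
      (prob p (PDEvent ends u a₂ c) + prob p (TEvent ends u a₂ c)) ≤
    (prob p (TEvent ends u a₂ c) - prob p (TEvent ends u a₂ c ∩ connEvent ends u b) +
        prob p (PDEvent ends u a₂ c ∩ connEvent ends a₂ b) +
        prob p (TEvent ends u a₂ c ∩ connEvent ends a₂ b)) *
      (prob p (PDEvent ends u a₂ c ∩ connEvent ends u o) +
        prob p (TEvent ends u a₂ c ∩ connEvent ends u o)) := by
  classical
  set N := avoidAll ends u {a₂, c} with hN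
  have ha2 : a₂ ∈ ({a₂, c} : Finset V) := by simp
  set gc := delClusterProb p ends a₂ {W | c ∈ W} with hgc
  set gb := delClusterProb p ends a₂ {W | b ∈ W} with hgb
  set χ : Set V → R := fun K => ({W : Set V | b ∉ W}).indicator 1 K with hχ
  -- tower identities (exploring `L = C(u)` avoiding `{a₂, c}`)
  have tO := prob_clusterIn_inter_avoid_eq_expect p ends u a₂ ha2 {W | o ∈ W} Set.univ
  have tBc := prob_clusterIn_inter_avoid_eq_expect p ends u a₂ ha2 {W | b ∉ W} {W | c ∈ W}
  have tBb := prob_clusterIn_inter_avoid_eq_expect p ends u a₂ ha2 {W | b ∉ W} {W | b ∈ W}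
  have tOBc := prob_clusterIn_inter_avoid_eq_expect p ends u a₂ ha2 ({W | o ∈ W} ∩ {W | b ∉ W})
    {W | c ∈ W}
  have tOBb := prob_clusterIn_inter_avoid_eq_expect p ends u a₂ ha2 ({W | o ∈ W} ∩ {W | b ∉ W})
    {W | b ∈ W}
  have hg1 : ∀ K, delClusterProb p ends a₂ Set.univ K = 1 := delClusterProb_univ p ends a₂
  simp only [clusterInEvent_univ, Set.inter_univ, hg1, mul_one] at tO tBc tBb tOBc tOBb
  -- monotonicity and bounds of the functionals
  have hgc_anti : Antitone gc := delClusterProb_anti p hp ends a₂ (ExploreA3.isUpperSet_mem c)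
  have hgb_anti : Antitone gb := delClusterProb_anti p hp ends a₂ (ExploreA3.isUpperSet_mem b)
  have hgc1 : ∀ K, gc K ≤ 1 := delClusterProb_le_one p hp ends a₂ _
  have hgb1 : ∀ K, gb K ≤ 1 := delClusterProb_le_one p hp ends a₂ _
  have hgc0 : ∀ K, 0 ≤ gc K := delClusterProb_nonneg p hp ends a₂ _
  have hgb0 : ∀ K, 0 ≤ gb K := delClusterProb_nonneg p hp ends a₂ _
  have hχ_anti : Antitone χ := by
    intro K K' h
    simp only [hχ]
    by_cases hb' : b ∈ K
    · have hb'' : b ∈ K' := h hb'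
      simp [Set.indicator, hb', hb'']
    · simp only [Set.indicator, Set.mem_setOf_eq, hb', not_false_eq_true, if_true, Pi.one_apply]
      split_ifs <;> norm_num
  have hχ0 : ∀ K, 0 ≤ χ K := fun K => Set.indicator_apply_nonneg fun _ => zero_le_one
  have hχ1 : ∀ K, χ K ≤ 1 := fun K => Set.indicator_apply_le' (fun _ => le_rfl) (fun _ => zero_le_one)
  have hF₁ : Monotone (fun K : Set V => ({W : Set V | o ∈ W}).indicator (1 : Set V → R) K) :=
    monotone_indicator_one_of_isUpperSet (ExploreA3.isUpperSet_mem o)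
  have hF₁0 : ∀ K, 0 ≤ ({W : Set V | o ∈ W}).indicator (1 : Set V → R) K :=
    fun K => Set.indicator_apply_nonneg fun _ => zero_le_one
  have hF₂ : Monotone (fun K => 2 - χ K * (gc K + gb K)) := by
    intro K K' h
    simp only
    have h1 := hχ_anti h
    have h2 : gc K' + gb K' ≤ gc K + gb K := by linarith [hgc_anti h, hgb_anti h]
    have : χ K' * (gc K' + gb K') ≤ χ K * (gc K + gb K) :=
      mul_le_mul h1 h2 (by linarith [hgc0 K', hgb0 K']) (hχ0 K)
    linarith
  have hF₂0 : ∀ K, 0 ≤ 2 - χ K * (gc K + gb K) := by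
    intro K
    have : χ K * (gc K + gb K) ≤ 1 * 2 :=
      mul_le_mul (hχ1 K) (by linarith [hgc1 K, hgb1 K]) (by linarith [hgc0 K, hgb0 K]) zero_le_one
    linarith
  -- the functional BHK on the cluster of `u` avoiding `{a₂, c}`
  have key := bhk_induced p hp ends u hF₁ hF₂ hF₁0 hF₂0 Finset.univ {a₂, c} {a₂, c}
    (Finset.subset_univ _) (Finset.subset_univ _)
  simp only [Finset.inter_self, Finset.union_self, REvent_univ] at key
  have e : ∀ F : Set V → R, clusterObs ends Finset.univ u F * (avoidAll ends u {a₂, c}).indicator 1 =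
      fun ω => F (cluster ends ω u) * (avoidAll ends u {a₂, c}).indicator 1 ω := by
    intro F
    funext ω
    simp only [Pi.mul_apply, clusterObs_apply, clusterIn_univ]
  rw [e, e, e] at key
  simp only [Pi.mul_apply] at key
  have eN : prob p N = expect p fun ω => N.indicator 1 ω := prob_eq_expect_indicator p _
  have e1 : expect p (fun ω => ({W : Set V | o ∈ W}).indicator (1 : Set V → R) (cluster ends ω u) *
      N.indicator 1 ω) = prob p (clusterInEvent ends u {W | o ∈ W} ∩ N) := by
    rw [tO]
  have e2 : expect p (fun ω => (2 - χ (cluster ends ω u) *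
      (gc (cluster ends ω u) + gb (cluster ends ω u))) * N.indicator 1 ω) =
      2 * prob p N - prob p (clusterInEvent ends u {W | b ∉ W} ∩ clusterInEvent ends a₂ {W | c ∈ W} ∩ N) -
        prob p (clusterInEvent ends u {W | b ∉ W} ∩ clusterInEvent ends a₂ {W | b ∈ W} ∩ N) := by
    rw [tBc, tBb, eN, ← expect_const_mul, ← expect_sub, ← expect_sub]
    congr 1
    funext ω
    simp only [Pi.sub_apply, hχ]
    ring
  have e12 : expect p (fun ω => ({W : Set V | o ∈ W}).indicator (1 : Set V → R) (cluster ends ω u) *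
      (2 - χ (cluster ends ω u) * (gc (cluster ends ω u) + gb (cluster ends ω u))) *
      N.indicator 1 ω) =
      2 * prob p (clusterInEvent ends u {W | o ∈ W} ∩ N) -
        prob p (clusterInEvent ends u ({W | o ∈ W} ∩ {W | b ∉ W}) ∩ clusterInEvent ends a₂ {W | c ∈ W} ∩ N) -
        prob p (clusterInEvent ends u ({W | o ∈ W} ∩ {W | b ∉ W}) ∩ clusterInEvent ends a₂ {W | b ∈ W} ∩ N) := by
    rw [tO, tOBc, tOBb, ← expect_const_mul, ← expect_sub, ← expect_sub]
    congr 1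
    funext ω
    simp only [Pi.sub_apply, hχ, Set.inter_indicator_one, Pi.mul_apply]
    ring
  rw [e1, e2, e12] at key
  simp only [ExploreA3.clusterInEvent_mem_eq, MixK.clusterInEvent_notMem_eq,
    MixK.clusterInEvent_mem_notMem_eq] at key
  -- the masses: `N ∩ X = (PD ∩ X) ⊔ (T ∩ X)`
  have split : ∀ X : Set (Config E), prob p (N ∩ X) =
      prob p (PDEvent ends u a₂ c ∩ X) + prob p (TEvent ends u a₂ c ∩ X) := by
    intro X
    have h := ISplit.prob_PD_add_T p ends u a₂ c X
    linarith
  have m1 : prob p (connEvent ends u o ∩ N) =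
      prob p (PDEvent ends u a₂ c ∩ connEvent ends u o) + prob p (TEvent ends u a₂ c ∩ connEvent ends u o) := by
    rw [Set.inter_comm, split]
  have m2 : prob p ((connEvent ends u b)ᶜ ∩ connEvent ends a₂ c ∩ N) =
      prob p (TEvent ends u a₂ c) - prob p (TEvent ends u a₂ c ∩ connEvent ends u b) := by
    have h := prob_inter_add_prob_inter_compl p (TEvent ends u a₂ c) (connEvent ends u b)
    have ee : (connEvent ends u b)ᶜ ∩ connEvent ends a₂ c ∩ N = TEvent ends u a₂ c ∩ (connEvent ends u b)ᶜ := by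
      rw [← R_inter_a2c_eq ends a₂ c u]
      ext ω
      simp only [Set.mem_inter_iff, Set.mem_compl_iff]
      tauto
    rw [ee]
    linarith
  have m3 : prob p ((connEvent ends u b)ᶜ ∩ connEvent ends a₂ b ∩ N) =
      prob p (PDEvent ends u a₂ c ∩ connEvent ends a₂ b) + prob p (TEvent ends u a₂ c ∩ connEvent ends a₂ b) := by
    have ee : (connEvent ends u b)ᶜ ∩ connEvent ends a₂ b ∩ N = N ∩ connEvent ends a₂ b := by
      ext ω
      simp only [Set.mem_inter_iff, Set.mem_compl_iff, hN, mem_avoidAll, Finset.mem_insert,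
        Finset.mem_singleton, forall_eq_or_imp, forall_eq, mem_connEvent]
      constructor
      · rintro ⟨⟨_, hab⟩, hN'⟩
        exact ⟨hN', hab⟩
      · rintro ⟨⟨hua, huc⟩, hab⟩
        exact ⟨⟨fun hub => hua (conn_trans hub (conn_symm hab)), hab⟩, hua, huc⟩
    rw [ee, split]
  have m4 : prob p (connEvent ends u o ∩ (connEvent ends u b)ᶜ ∩ connEvent ends a₂ c ∩ N) =
      prob p (TEvent ends u a₂ c ∩ connEvent ends u o) -
        prob p (TEvent ends u a₂ c ∩ (connEvent ends u o ∩ connEvent ends u b)) := by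
    have h := prob_inter_add_prob_inter_compl p (TEvent ends u a₂ c ∩ connEvent ends u o) (connEvent ends u b)
    have ee : connEvent ends u o ∩ (connEvent ends u b)ᶜ ∩ connEvent ends a₂ c ∩ N =
        TEvent ends u a₂ c ∩ connEvent ends u o ∩ (connEvent ends u b)ᶜ := by
      rw [← R_inter_a2c_eq ends a₂ c u]
      ext ω
      simp only [Set.mem_inter_iff, Set.mem_compl_iff]
      tauto
    have ee2 : TEvent ends u a₂ c ∩ connEvent ends u o ∩ connEvent ends u b =
        TEvent ends u a₂ c ∩ (connEvent ends u o ∩ connEvent ends u b) := Set.inter_assoc _ _ _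
    rw [ee2] at h
    rw [ee]
    linarith
  have m5 : prob p (connEvent ends u o ∩ (connEvent ends u b)ᶜ ∩ connEvent ends a₂ b ∩ N) =
      prob p (PDEvent ends u a₂ c ∩ (connEvent ends u o ∩ connEvent ends a₂ b)) +
        prob p (TEvent ends u a₂ c ∩ (connEvent ends u o ∩ connEvent ends a₂ b)) := by
    have ee : connEvent ends u o ∩ (connEvent ends u b)ᶜ ∩ connEvent ends a₂ b ∩ N =
        N ∩ (connEvent ends u o ∩ connEvent ends a₂ b) := by
      ext ω
      simp only [Set.mem_inter_iff, Set.mem_compl_iff, hN, mem_avoidAll, Finset.mem_insert,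
        Finset.mem_singleton, forall_eq_or_imp, forall_eq, mem_connEvent]
      constructor
      · rintro ⟨⟨⟨huo, _⟩, hab⟩, hN'⟩
        exact ⟨hN', huo, hab⟩
      · rintro ⟨⟨hua, huc⟩, huo, hab⟩
        exact ⟨⟨⟨huo, fun hub => hua (conn_trans hub (conn_symm hab))⟩, hab⟩, hua, huc⟩
    rw [ee, split]
  have mN : prob p N = prob p (PDEvent ends u a₂ c) + prob p (TEvent ends u a₂ c) := by
    have h := split Set.univ
    simpa only [Set.inter_univ] using h
  rw [m1, m2, m3, m4, m5, mN] at key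
  nlinarith [key]

end BHK

section Classes

variable (p : E → R) (ends : E → Sym2 V) (o a₂ c b u : V)

/-- **The `o ∈ L` half on the class `(2β + B)·δ_o ≤ (OU)·Y`** (`B = α − κ ≤ 0`, `δ_o = t·Y_N − D·Y_t`,
`(OU) = T2oL(o := u)`): `0 ≤ T2oL`. -/
theorem T2oL_nonneg_of_classL (hp : IsProbVec p)
    (hcls : (2 * (prob p Set.univ * prob p (PDEvent ends u a₂ c) +
          prob p (avoidAll ends a₂ {c}) * prob p (avoidAll ends a₂ {u})) +
        ((prob p (PDEvent ends u a₂ c) * prob p (connEvent ends a₂ b) +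
            prob p (avoidAll ends a₂ {c}) * gap p ends u a₂ b) -
          (prob p Set.univ * EQb3 p ends u a₂ c b + prob p Set.univ * PDb p ends u a₂ c b +
            prob p (connEvent ends a₂ b) * EQ3 p ends u a₂ c +
            prob p (connEvent ends a₂ b) * prob p (avoidAll ends a₂ {u}) -
            (prob p Set.univ - prob p (avoidAll ends a₂ {c})) * gap p ends u a₂ b))) *
        (prob p (TEvent ends u a₂ c) * prob p (PDEvent ends u a₂ c ∩ connEvent ends u o) -
          prob p (PDEvent ends u a₂ c) * prob p (TEvent ends u a₂ c ∩ connEvent ends u o)) ≤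
      T2oL p ends u a₂ c b u *
        (prob p (PDEvent ends u a₂ c ∩ connEvent ends u o) +
          prob p (TEvent ends u a₂ c ∩ connEvent ends u o))) :
    0 ≤ T2oL p ends o a₂ c b u := by
  apply T2oL_nonneg_of_mixL p ends o a₂ c b u hp
  have hcov := cov_bnotL_le p ends o a₂ c b u hp
  have hβ : 0 ≤ prob p Set.univ * prob p (PDEvent ends u a₂ c) +
      prob p (avoidAll ends a₂ {c}) * prob p (avoidAll ends a₂ {u}) :=
    add_nonneg (mul_nonneg (prob_nonneg hp _) (prob_nonneg hp _))
      (mul_nonneg (prob_nonneg hp _) (prob_nonneg hp _))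
  nlinarith [mul_nonneg hβ (sub_nonneg.2 hcov)]

end Classes

end MixL

end RootLeafU

end Summit.Ventures.PercRepro2
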